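import Summits.CriticalPhenomena.PercolationContinuityZ3.Theses.PercNearOneGluing
import Literature.Probability.Percolation.PercolationProofs
import Literature.Probability.Percolation.ConditionalPositiveAssociationProofs
import Literature.Probability.Percolation.TwoClusterConditionalAssociationProofs

/-! TTRL-lite variant V137 of stmt-CriticalPhenomena-4576 -/

namespace Summit.CriticalPhenomena.PercolationContinuityZ3.Theorems

open MeasureTheory Literature.Probability.LatticeModels Literature.Probability.Percolation
open scoped Classical BigOperators

/-- TTRL-lite variant V137 (n := 2, `A.card = 2`) of the good-step inequality of
stmt-CriticalPhenomena-4576.  On `Fin 2` a finset with `A.card = 2` is all of `Finset.univ`,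
contradicting `o ∉ A`, so the statement holds vacuously. -/
theorem cp4576_goodstep_var137 :
    ∀ (w : Sym2 (Fin 2) → unitInterval) (A : Finset (Fin 2)) (o b : Fin 2), A.card = 2 → b ∈ A →
      o ∉ A → (∃ y : Fin 2, y ∉ A ∧ y ≠ o ∧ (w s(o, y) : ℝ) ≠ 0) →
      (∀ w' : Sym2 (Fin 2) → unitInterval,
        (Finset.univ.filter (fun v : Fin 2 => ∃ u : Fin 2, 0 < (w' s(u, v) : ℝ))).card <
          (Finset.univ.filter (fun v : Fin 2 => ∃ u : Fin 2, 0 < (w s(u, v) : ℝ))).card →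
        ∀ (A' : Finset (Fin 2)) (o' b' : Fin 2), b' ∈ A' → o' ∉ A' →
          ∀ (t : ℝ) (sel : Finset (Fin 2) → Fin 2), (∀ W, sel W ∈ A') →
            (∀ a ∈ A', 1 - t ≤ (prodBernoulli w').real (openConn a b')) →
            (prodBernoulli w').real ((⋃ a ∈ A', openConn o' a) ∩ (openConn o' b')ᶜ) +
              ∑ W ∈ (Finset.univ : Finset (Finset (Fin 2))).filter
                  (fun W => o' ∈ W ∧ Disjoint W A'),
                (prodBernoulli w').real
                    {ω : BondConfig (Fin 2) | openCluster ω o' = (W : Set (Fin 2))} *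
                  (prodBernoulli w').real (openConnIn ((W : Set (Fin 2))ᶜ) (sel W) b')ᶜ ≤ t) →
      ∀ (t : ℝ) (sel : Finset (Fin 2) → Fin 2), (∀ W, sel W ∈ A) →
        (∀ a ∈ A, 1 - t ≤ (prodBernoulli w).real (openConn a b)) →
        (prodBernoulli w).real ((⋃ a ∈ A, openConn o a) ∩ (openConn o b)ᶜ) +
          ∑ W ∈ (Finset.univ : Finset (Finset (Fin 2))).filter
              (fun W => o ∈ W ∧ Disjoint W A),
            (prodBernoulli w).real
                {ω : BondConfig (Fin 2) | openCluster ω o = (W : Set (Fin 2))} *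
              (prodBernoulli w).real (openConnIn ((W : Set (Fin 2))ᶜ) (sel W) b)ᶜ ≤ t := by
  intro w A o b hcard _hb ho
  exfalso
  have hA : A = Finset.univ :=
    Finset.eq_univ_of_card A (by rw [hcard, Fintype.card_fin])
  exact ho (hA ▸ Finset.mem_univ o)

end Summit.CriticalPhenomena.PercolationContinuityZ3.Theorems
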